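import Summits.BirchSwinnertonDyer.Rank1Residual.AdditivePotMult.PotMultCongruentPairGVBudgetRank
import HarnessLib

/-!
# Route-G budgets on the (G-ord, `e = 2`) rows from a GV congruent partner of EITHER type, EPW-free,
# partner in the weak currency and in RANK currency — the (G-ord)-row companion of
# `PotMultCongruentPairGVBudget[Rank]` (cell `b2b-bsdres`, team n1011, seat p07 (gen 6); OWNERS row
# T-E3d-GV FILE 4 (offered to p05 / p10 successor first); consumer of cc-typer-2's
# `TorsionOrderOfTorsionIso` §3 ((G-ord)–(G-ord)) and of p07-g5's `MixedCongruentPairGV` ((G-ord)–(M)))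

HONEST FRAMING (cell `b2b-bsdres`, run/shared/lean/b2b/bsd-rank1-residual/, verbatim in every
file): the goal of the cell is to DELETE the COMBINATION-SHAPED residual classes of the
Birch–Swinnerton-Dyer formula for ALL analytic-rank `≤ 1` elliptic curves over `ℚ` — "full BSD
formula for every rank `≤ 1` curve in class `C`" assembled STRICTLY from published theorems — so
that the rank-`≤ 1` remainder becomes exactly the CONSTRUCTION-SHAPED classes, which are TYPED
(missing-input `Prop`s), NOT attempted. This is not "finishing BSD". Team n1011 (N10/N11, (G-ord,
`e = 2`) rows = X4♯(G-ord) ∩ `I₀*` / X3♯(G-ord) ∩ `I₀*`, every odd `p` incl. `3`): research route;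
labels and marks UNCHANGED; nothing booked. Consumer theorems only; NO definition; NO Literature fact;
named facts as HYPOTHESES: `hGV` (GV §2 composed record A240), `hGrK` (A239), A40/A41 (`hT40`/`hT41`,
(M) partner only), `hK` (Kato 2004 Thm. 17.4 (3), X4 partners), `hW16` (Wuthrich 2014 Thm. 16, X3♯
partners), `hmodD`. Debt 0.

## What

n1011-p10's typed budget `BudgetLeLambdaAt p W b` on a (G-ord, `e = 2`) row `W` from a congruent
partner `W₁` through the GV record, by p07-g6's schema lemma
`budgetLeLambdaAt_of_congruentLambdaShift_of_muTransfer` over the binder-free GV shifts and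
`μ`-transfers of cc-typer-2 (`ClassX4Gord/ClassX3Gord.congruentLambdaShift/mu_eq_zero_of_gv_of_grK_of_torsionIso`,
(G-ord)–(G-ord)) and of p07-g5 (`ClassX4Gord/ClassX3Gord.…_of_gv_of_multPartner`, (G-ord)–(M)):
* §1 weak partner currency (`h₁` : torsion ∧ (`μ = 0 ⟹ r₁ ≤ λ`)):
  `ClassX4Gord.budgetLeLambdaAt_of_gv_of_{gord,mult}Partner_of_congr`,
  `ClassX3Gord.budgetLeLambdaAt_of_gv_of_{gord,mult}Partner_of_congr`;
* §2 RANK currency (nothing at the partner but class, image (X4) and `r₁ ≤ rank E₁(ℚ)`):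
  `ClassX4Gord.budgetLeLambdaAt_of_gv_of_{gord,mult}Partner_of_rank` (partner input: g5
  `ClassX4Gord.isTorsion_and_le_lambdaInvariant_of_katoHalf` / g3 `ClassX4M.…_of_katoHalf`),
  `ClassX3Gord.budgetLeLambdaAt_of_gv_of_{gord,mult}Partner_of_rank` (partner input: g6
  `ClassX3Gord/ClassX3M.isTorsion_and_le_lambdaInvariant_of_wuthrichHalf` — NO certificate).
On X4♯(G-ord) this is the EPW-free second source of p10's / g5's EPW budgets; on X3♯(G-ord) (`ρ̄`
REDUCIBLE, EPW inapplicable) the first congruence-sourced budget whose every per-pair input is a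
certificate (`TorsionIso`, `Σ₀`, ONE census bit `p ∤ #E(ℚ)_tors`) or a rank. X3♯/X4♯(G-ord) stay
CONSTRUCTION-SHAPED; nothing booked; no mark moved. `e ∈ {3,4,6}` rows NOT treated (no R-D there).

References: R. Greenberg, V. Vatsal, Invent. Math. 142 (2000) §2 [GreenbergVatsal2000]; R. Greenberg,
LNM 1716 (1999) §2 Props. 2.2, 2.4, §3 Lemma 3.1, Prop. 4.14 [GreenbergLNM1716]; C. Wuthrich (2014)
Thm. 16 [Wuthrich2014]; K. Kato, Astérisque 295 (2004) Thm. 17.4 (3) [Kato2004Asterisque]; B. Mazur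
(1977) III §5 [Mazur1977]; J. H. Silverman, *ATAEC* V.5.3–5.4 [SilvermanATAEC1994].
-/

set_option autoImplicit false

noncomputable section

open scoped Classical MatrixGroups ModularForm NumberField

open CongruenceSubgroup WeierstrassCurve NumberField IsDedekindDomain Field
  Literature.NumberTheory.EllipticCurves
  Literature.NumberTheory.EllipticCurves.ModularForms
  Literature.NumberTheory.EllipticCurves.Rank1Residual
  Literature.NumberTheory.EllipticCurves.Rank1Residual.Typed
  Literature.NumberTheory.EllipticCurves.GreenbergSelmer
  Literature.NumberTheory.EllipticCurves.Greenberg1999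
  Literature.NumberTheory.EllipticCurves.Wuthrich2014
  Literature.NumberTheory.EllipticCurves.GreenbergVatsal2000
  Literature.NumberTheory.GaloisRepresentations
  Summit.BirchSwinnertonDyer.Rank1Residual.X1.MuLambda
  Summit.BirchSwinnertonDyer.Rank1Residual.X11a
  Summit.BirchSwinnertonDyer.Rank1Residual.Iwasawa

open Summit.BirchSwinnertonDyer.Rank1Residual.X1.CongruenceTransfer (TorsionIso CongruentLambdaShift)

namespace Summit.BirchSwinnertonDyer.Rank1Residual.Additive

open Summit.BirchSwinnertonDyer.Rank1Residual.AdditivePotMult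

variable {W W₁ : WeierstrassCurve ℚ} [W.IsElliptic] [W.IsGloballyMinimal] [W₁.IsElliptic]
  [W₁.IsGloballyMinimal] {p : ℕ} [hp : Fact p.Prime]

/-! ### §1 (G-ord, `e = 2`)-row budgets from the GV record, weak partner currency -/

/-- **X4♯(G-ord) ∩ `I₀*` row, X4♯(G-ord) ∩ `I₀*` partner: the EPW-free Route-G budget from the GV
record** — `BudgetLeLambdaAt p W b` for `b ≤ r₁ + Σ_{w∈Σ₀} (δ(E₁,w) − δ(E,w))`, inputs `hGV`, `hGrK`,
`TorsionIso`, `Σ₀`, a partner with torsion cyclotomic dual data and `μ = 0 ⟹ r₁ ≤ λ`; torsion bits by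
irreducibility; NO line / R-D / image binder (cc-typer-2's `…_of_gv_of_grK_of_torsionIso`). Nothing booked.
[cite: GreenbergVatsal2000, §2 Prop. (2.8) with Remark (2.9), Cor. (2.3), Prop. (2.4), pp. 26–27 (arXiv:math/9906215)]
[cite: GreenbergLNM1716, §2 Props. 2.2, 2.4 (pp. 73–75)] -/
theorem ClassX4Gord.budgetLeLambdaAt_of_gv_of_gordPartner_of_congr
    (hGV : muLambdaAlg_transfer_of_torsionIso_potOrd_of_not_dvd_torsionOrder)
    (hGrK : imKummer_ge_strictCondition_goodOrdinary)
    (hX : ClassX4Gord W p) (he : semistabilityIndex W p = 2)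
    (hX₁ : ClassX4Gord W₁ p) (he₁ : semistabilityIndex W₁ p = 2) (hT : TorsionIso W W₁ p)
    (S₀ : Finset (HeightOneSpectrum (𝓞 ℚ))) (hS₀ : ∀ w ∈ S₀, ((p : ℕ) : 𝓞 ℚ) ∉ w.asIdeal)
    (hS : ∀ w : HeightOneSpectrum (𝓞 ℚ), w ∉ S₀ → ((p : ℕ) : 𝓞 ℚ) ∉ w.asIdeal →
      W.HasGoodReductionAt w)
    (hS₁ : ∀ w : HeightOneSpectrum (𝓞 ℚ), w ∉ S₀ → ((p : ℕ) : 𝓞 ℚ) ∉ w.asIdeal →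
      W₁.HasGoodReductionAt w)
    {r₁ : ℕ}
    (h₁ : ∀ {κ : ZpExtension ℚ p} {γ : absoluteGaloisGroup ℚ},
      κ.IsCyclotomic → κ.IsTopGenerator γ → IsCyclotomicVariable p γ →
      ∀ (D₁ : W₁.SelmerDualData κ γ) [Module.Finite (IwasawaAlgebra p) D₁.X],
        D₁.IsTorsion ∧ (D₁.mu = 0 → r₁ ≤ lambdaInvariant p D₁.X))
    {b : ℕ} (hb : (b : ℤ) ≤ r₁ + ∑ w ∈ S₀, ((delta W₁ p w : ℤ) - (delta W p w : ℤ))) :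
    BudgetLeLambdaAt p W b :=
  budgetLeLambdaAt_of_congruentLambdaShift_of_muTransfer hT
    (ClassX4Gord.congruentLambdaShift_of_gv_of_grK_of_torsionIso hGV hGrK hX he hX₁ he₁ hT S₀ hS₀ hS hS₁)
    (fun hκ hγ hγ' D D₁ _ _ hXt hX₁t hmu ↦
      ClassX4Gord.mu_eq_zero_of_gv_of_grK_of_torsionIso hGV hGrK hX he hX₁ he₁ hT S₀ hS₀ hS hS₁ hκ hγ
        hγ' D D₁ hXt hX₁t hmu)
    h₁ hb

/-- **X4♯(G-ord) ∩ `I₀*` row, X4(M) partner: the EPW-free Route-G budget from the GV record**, mod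
`hGrK` | A40/A41 (p07-g5's `ClassX4Gord.…_of_gv_of_multPartner`). Nothing booked.
[cite: GreenbergVatsal2000, §2 Prop. (2.8) with Remark (2.9), Cor. (2.3), Prop. (2.4), pp. 26–27 (arXiv:math/9906215)]
[cite: Mazur1977, Ch. III §5, p. 157] [cite: SilvermanATAEC1994, Ch. V Thm. 5.3, Cor. 5.4] -/
theorem ClassX4Gord.budgetLeLambdaAt_of_gv_of_multPartner_of_congr
    (hGV : muLambdaAlg_transfer_of_torsionIso_potOrd_of_not_dvd_torsionOrder)
    (hGrK : imKummer_ge_strictCondition_goodOrdinary)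
    (hT40 : Silverman1994_thmV53_tateUniformisation.{0})
    (hT41 : Silverman1994_thmV53_corV54_tateUniformisation.{0})
    (hX : ClassX4Gord W p) (he : semistabilityIndex W p = 2) (hX₁ : ClassX4M W₁ p)
    (hT : TorsionIso W W₁ p)
    (S₀ : Finset (HeightOneSpectrum (𝓞 ℚ))) (hS₀ : ∀ w ∈ S₀, ((p : ℕ) : 𝓞 ℚ) ∉ w.asIdeal)
    (hS : ∀ w : HeightOneSpectrum (𝓞 ℚ), w ∉ S₀ → ((p : ℕ) : 𝓞 ℚ) ∉ w.asIdeal →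
      W.HasGoodReductionAt w)
    (hS₁ : ∀ w : HeightOneSpectrum (𝓞 ℚ), w ∉ S₀ → ((p : ℕ) : 𝓞 ℚ) ∉ w.asIdeal →
      W₁.HasGoodReductionAt w)
    {r₁ : ℕ}
    (h₁ : ∀ {κ : ZpExtension ℚ p} {γ : absoluteGaloisGroup ℚ},
      κ.IsCyclotomic → κ.IsTopGenerator γ → IsCyclotomicVariable p γ →
      ∀ (D₁ : W₁.SelmerDualData κ γ) [Module.Finite (IwasawaAlgebra p) D₁.X],
        D₁.IsTorsion ∧ (D₁.mu = 0 → r₁ ≤ lambdaInvariant p D₁.X))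
    {b : ℕ} (hb : (b : ℤ) ≤ r₁ + ∑ w ∈ S₀, ((delta W₁ p w : ℤ) - (delta W p w : ℤ))) :
    BudgetLeLambdaAt p W b :=
  budgetLeLambdaAt_of_congruentLambdaShift_of_muTransfer hT
    (AdditivePotMult.ClassX4Gord.congruentLambdaShift_of_gv_of_multPartner hGV hGrK hT40 hT41 hX he hX₁
      hT S₀ hS₀ hS hS₁)
    (fun hκ hγ hγ' D D₁ _ _ hXt hX₁t hmu ↦
      AdditivePotMult.ClassX4Gord.mu_eq_zero_of_gv_of_multPartner hGV hGrK hT40 hT41 hX he hX₁ hT S₀ hS₀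
        hS hS₁ hκ hγ hγ' D D₁ hXt hX₁t hmu)
    h₁ hb

/-- **X3♯(G-ord) ∩ `I₀*` row, X3♯(G-ord) ∩ `I₀*` partner (`ρ̄` REDUCIBLE, odd `p`): the Route-G budget
from the GV record** — inputs `hGV`, `hGrK`, ONE census bit `p ∤ #E(ℚ)_tors`, `TorsionIso`, `Σ₀`, a
partner with torsion cyclotomic dual data and `μ = 0 ⟹ r₁ ≤ λ`; NO line / R-D / image binder
(cc-typer-2's `ClassX3Gord.…_of_gv_of_grK_of_torsionIso`). X3♯(G-ord) stays CONSTRUCTION-SHAPED; nothing booked.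
[cite: GreenbergVatsal2000, §2 Prop. (2.8) with Remark (2.9), Cor. (2.3), Prop. (2.4), pp. 26–27 (arXiv:math/9906215)]
[cite: GreenbergLNM1716, Prop. 4.14, §2 Props. 2.2, 2.4 (pp. 73–75)] -/
theorem ClassX3Gord.budgetLeLambdaAt_of_gv_of_gordPartner_of_congr
    (hGV : muLambdaAlg_transfer_of_torsionIso_potOrd_of_not_dvd_torsionOrder)
    (hGrK : imKummer_ge_strictCondition_goodOrdinary) (hp2 : p ≠ 2)
    (hX : ClassX3Gord W p) (he : semistabilityIndex W p = 2)
    (hX₁ : ClassX3Gord W₁ p) (he₁ : semistabilityIndex W₁ p = 2)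
    (htors : ¬ p ∣ W.torsionOrder) (hT : TorsionIso W W₁ p)
    (S₀ : Finset (HeightOneSpectrum (𝓞 ℚ))) (hS₀ : ∀ w ∈ S₀, ((p : ℕ) : 𝓞 ℚ) ∉ w.asIdeal)
    (hS : ∀ w : HeightOneSpectrum (𝓞 ℚ), w ∉ S₀ → ((p : ℕ) : 𝓞 ℚ) ∉ w.asIdeal →
      W.HasGoodReductionAt w)
    (hS₁ : ∀ w : HeightOneSpectrum (𝓞 ℚ), w ∉ S₀ → ((p : ℕ) : 𝓞 ℚ) ∉ w.asIdeal →
      W₁.HasGoodReductionAt w)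
    {r₁ : ℕ}
    (h₁ : ∀ {κ : ZpExtension ℚ p} {γ : absoluteGaloisGroup ℚ},
      κ.IsCyclotomic → κ.IsTopGenerator γ → IsCyclotomicVariable p γ →
      ∀ (D₁ : W₁.SelmerDualData κ γ) [Module.Finite (IwasawaAlgebra p) D₁.X],
        D₁.IsTorsion ∧ (D₁.mu = 0 → r₁ ≤ lambdaInvariant p D₁.X))
    {b : ℕ} (hb : (b : ℤ) ≤ r₁ + ∑ w ∈ S₀, ((delta W₁ p w : ℤ) - (delta W p w : ℤ))) :
    BudgetLeLambdaAt p W b :=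
  budgetLeLambdaAt_of_congruentLambdaShift_of_muTransfer hT
    (ClassX3Gord.congruentLambdaShift_of_gv_of_grK_of_torsionIso hGV hGrK hp2 hX he hX₁ he₁ htors hT S₀
      hS₀ hS hS₁)
    (fun hκ hγ hγ' D D₁ _ _ hXt hX₁t hmu ↦
      ClassX3Gord.mu_eq_zero_of_gv_of_grK_of_torsionIso hGV hGrK hp2 hX he hX₁ he₁ htors hT S₀ hS₀ hS hS₁
        hκ hγ hγ' D D₁ hXt hX₁t hmu)
    h₁ hb

/-- **X3♯(G-ord) ∩ `I₀*` row, X3♯(M) partner (odd `p`): the Route-G budget from the GV record**, mod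
`hGrK` | A40/A41; ONE census bit `p ∤ #E(ℚ)_tors` (p07-g5's `ClassX3Gord.…_of_gv_of_multPartner`).
Nothing booked.
[cite: GreenbergVatsal2000, §2 Prop. (2.8) with Remark (2.9), Cor. (2.3), Prop. (2.4), pp. 26–27 (arXiv:math/9906215)]
[cite: GreenbergLNM1716, Prop. 4.14, §2 Props. 2.2, 2.4] [cite: SilvermanATAEC1994, Ch. V Thm. 5.3, Cor. 5.4] -/
theorem ClassX3Gord.budgetLeLambdaAt_of_gv_of_multPartner_of_congr
    (hGV : muLambdaAlg_transfer_of_torsionIso_potOrd_of_not_dvd_torsionOrder)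
    (hGrK : imKummer_ge_strictCondition_goodOrdinary)
    (hT40 : Silverman1994_thmV53_tateUniformisation.{0})
    (hT41 : Silverman1994_thmV53_corV54_tateUniformisation.{0})
    (hX : ClassX3Gord W p) (he : semistabilityIndex W p = 2) (hX₁ : ClassX3M W₁ p)
    (htors : ¬ p ∣ W.torsionOrder) (hT : TorsionIso W W₁ p)
    (S₀ : Finset (HeightOneSpectrum (𝓞 ℚ))) (hS₀ : ∀ w ∈ S₀, ((p : ℕ) : 𝓞 ℚ) ∉ w.asIdeal)
    (hS : ∀ w : HeightOneSpectrum (𝓞 ℚ), w ∉ S₀ → ((p : ℕ) : 𝓞 ℚ) ∉ w.asIdeal →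
      W.HasGoodReductionAt w)
    (hS₁ : ∀ w : HeightOneSpectrum (𝓞 ℚ), w ∉ S₀ → ((p : ℕ) : 𝓞 ℚ) ∉ w.asIdeal →
      W₁.HasGoodReductionAt w)
    {r₁ : ℕ}
    (h₁ : ∀ {κ : ZpExtension ℚ p} {γ : absoluteGaloisGroup ℚ},
      κ.IsCyclotomic → κ.IsTopGenerator γ → IsCyclotomicVariable p γ →
      ∀ (D₁ : W₁.SelmerDualData κ γ) [Module.Finite (IwasawaAlgebra p) D₁.X],
        D₁.IsTorsion ∧ (D₁.mu = 0 → r₁ ≤ lambdaInvariant p D₁.X))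
    {b : ℕ} (hb : (b : ℤ) ≤ r₁ + ∑ w ∈ S₀, ((delta W₁ p w : ℤ) - (delta W p w : ℤ))) :
    BudgetLeLambdaAt p W b :=
  budgetLeLambdaAt_of_congruentLambdaShift_of_muTransfer hT
    (AdditivePotMult.ClassX3Gord.congruentLambdaShift_of_gv_of_multPartner hGV hGrK hT40 hT41 hX he hX₁
      htors hT S₀ hS₀ hS hS₁)
    (fun hκ hγ hγ' D D₁ _ _ hXt hX₁t hmu ↦
      AdditivePotMult.ClassX3Gord.mu_eq_zero_of_gv_of_multPartner hGV hGrK hT40 hT41 hX he hX₁ htors hT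
        S₀ hS₀ hS hS₁ hκ hγ hγ' D D₁ hXt hX₁t hmu)
    h₁ hb

/-! ### §2 (G-ord, `e = 2`)-row budgets, partner in RANK currency -/

/-- **X4♯(G-ord) ∩ `I₀*` row, X4♯(G-ord) ∩ `I₀*` ∧ surj(p) partner of rank `≥ r₁`: the EPW-free Route-G
budget** from `hGV`, `hGrK`, `hK`, `hmodD`, a `TorsionIso` certificate, `Σ₀`, `ρ̄_{E₁,p}` onto,
`r₁ ≤ rank E₁(ℚ)` (§1 + g5's `ClassX4Gord.isTorsion_and_le_lambdaInvariant_of_katoHalf`). The EPW-free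
twin of g5's `ClassX4Gord.budgetLeLambdaAt_of_epw_of_gordPartner_of_congr`. PER PAIR; nothing booked.
[cite: GreenbergVatsal2000, §2 Prop. (2.8) with Remark (2.9), Cor. (2.3), Prop. (2.4), pp. 26–27 (arXiv:math/9906215)]
[cite: Kato2004Asterisque, Thm. 17.4 (3) (p. 273)] [cite: GreenbergLNM1716, §2 Props. 2.2, 2.4, §3 Lemma 3.1] -/
theorem ClassX4Gord.budgetLeLambdaAt_of_gv_of_gordPartner_of_rank
    (hGV : muLambdaAlg_transfer_of_torsionIso_potOrd_of_not_dvd_torsionOrder)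
    (hGrK : imKummer_ge_strictCondition_goodOrdinary)
    (hK : Wuthrich2014.kato_halfEigenCharIdeal_dvd_cyclotomicPrime_of_surjective)
    (hmodD : nonempty_modularParametrizationData)
    (hX : ClassX4Gord W p) (he : semistabilityIndex W p = 2)
    (hX₁ : ClassX4Gord W₁ p) (he₁ : semistabilityIndex W₁ p = 2) (hsurj₁ : Surj W₁ p) {r₁ : ℕ}
    (hr₁ : r₁ ≤ W₁.mordellWeilRank) (hT : TorsionIso W W₁ p)
    (S₀ : Finset (HeightOneSpectrum (𝓞 ℚ))) (hS₀ : ∀ w ∈ S₀, ((p : ℕ) : 𝓞 ℚ) ∉ w.asIdeal)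
    (hS : ∀ w : HeightOneSpectrum (𝓞 ℚ), w ∉ S₀ → ((p : ℕ) : 𝓞 ℚ) ∉ w.asIdeal →
      W.HasGoodReductionAt w)
    (hS₁ : ∀ w : HeightOneSpectrum (𝓞 ℚ), w ∉ S₀ → ((p : ℕ) : 𝓞 ℚ) ∉ w.asIdeal →
      W₁.HasGoodReductionAt w)
    {b : ℕ} (hb : (b : ℤ) ≤ r₁ + ∑ w ∈ S₀, ((delta W₁ p w : ℤ) - (delta W p w : ℤ))) :
    BudgetLeLambdaAt p W b :=
  hX.budgetLeLambdaAt_of_gv_of_gordPartner_of_congr hGV hGrK he hX₁ he₁ hT S₀ hS₀ hS hS₁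
    (fun hκ hγ hγ' D₁ _ ↦
      hX₁.isTorsion_and_le_lambdaInvariant_of_katoHalf hK hmodD he₁ hsurj₁ hr₁ hκ hγ hγ' D₁) hb

/-- **X4♯(G-ord) ∩ `I₀*` row, X4(M) ∧ surj(p) partner of rank `≥ r₁`: the EPW-free Route-G budget**,
mod `hGrK` | A40/A41 (§1 + g3's `ClassX4M.isTorsion_and_le_lambdaInvariant_of_katoHalf`). The EPW-free
twin of g5's `ClassX4Gord.budgetLeLambdaAt_of_epw_of_multPartner_of_congr`. PER PAIR; nothing booked.
[cite: GreenbergVatsal2000, §2 Prop. (2.8) with Remark (2.9), Cor. (2.3), Prop. (2.4), pp. 26–27 (arXiv:math/9906215)]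
[cite: Kato2004Asterisque, Thm. 17.4 (3) (p. 273)] [cite: SilvermanATAEC1994, Ch. V Thm. 5.3, Cor. 5.4] -/
theorem ClassX4Gord.budgetLeLambdaAt_of_gv_of_multPartner_of_rank
    (hGV : muLambdaAlg_transfer_of_torsionIso_potOrd_of_not_dvd_torsionOrder)
    (hGrK : imKummer_ge_strictCondition_goodOrdinary)
    (hK : Wuthrich2014.kato_halfEigenCharIdeal_dvd_cyclotomicPrime_of_surjective)
    (hmodD : nonempty_modularParametrizationData)
    (hT40 : Silverman1994_thmV53_tateUniformisation.{0})
    (hT41 : Silverman1994_thmV53_corV54_tateUniformisation.{0})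
    (hX : ClassX4Gord W p) (he : semistabilityIndex W p = 2)
    (hX₁ : ClassX4M W₁ p) (hsurj₁ : Surj W₁ p) {r₁ : ℕ} (hr₁ : r₁ ≤ W₁.mordellWeilRank)
    (hT : TorsionIso W W₁ p)
    (S₀ : Finset (HeightOneSpectrum (𝓞 ℚ))) (hS₀ : ∀ w ∈ S₀, ((p : ℕ) : 𝓞 ℚ) ∉ w.asIdeal)
    (hS : ∀ w : HeightOneSpectrum (𝓞 ℚ), w ∉ S₀ → ((p : ℕ) : 𝓞 ℚ) ∉ w.asIdeal →
      W.HasGoodReductionAt w)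
    (hS₁ : ∀ w : HeightOneSpectrum (𝓞 ℚ), w ∉ S₀ → ((p : ℕ) : 𝓞 ℚ) ∉ w.asIdeal →
      W₁.HasGoodReductionAt w)
    {b : ℕ} (hb : (b : ℤ) ≤ r₁ + ∑ w ∈ S₀, ((delta W₁ p w : ℤ) - (delta W p w : ℤ))) :
    BudgetLeLambdaAt p W b :=
  hX.budgetLeLambdaAt_of_gv_of_multPartner_of_congr hGV hGrK hT40 hT41 he hX₁ hT S₀ hS₀ hS hS₁
    (fun hκ hγ hγ' D₁ _ ↦
      hX₁.isTorsion_and_le_lambdaInvariant_of_katoHalf hK hmodD hsurj₁ hr₁ hκ hγ hγ' D₁) hb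

/-- **X3♯(G-ord) ∩ `I₀*` row, X3♯(G-ord) ∩ `I₀*` partner of rank `≥ r₁` (odd `p`) — NO partner
certificate, NO schema hypothesis:** `BudgetLeLambdaAt p W b` from `hGV`, `hGrK`, `hW16`, `hmodD`, a
`TorsionIso` certificate, `Σ₀`, ONE census bit `p ∤ #E(ℚ)_tors` and `r₁ ≤ rank E₁(ℚ)` (§1 + g6's
`ClassX3Gord.isTorsion_and_le_lambdaInvariant_of_wuthrichHalf`). PER PAIR; X3♯(G-ord) stays
CONSTRUCTION-SHAPED; nothing booked.
[cite: GreenbergVatsal2000, §2 Prop. (2.8) with Remark (2.9), Cor. (2.3), Prop. (2.4), pp. 26–27 (arXiv:math/9906215)]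
[cite: Wuthrich2014, Thm. 16 (p. 397)] [cite: GreenbergLNM1716, Prop. 4.14, §2 Props. 2.2, 2.4, §3 Lemma 3.1] -/
theorem ClassX3Gord.budgetLeLambdaAt_of_gv_of_gordPartner_of_rank
    (hGV : muLambdaAlg_transfer_of_torsionIso_potOrd_of_not_dvd_torsionOrder)
    (hGrK : imKummer_ge_strictCondition_goodOrdinary)
    (hW16 : Wuthrich2014.thm16_halfEigenCharIdeal_dvd_cyclotomicPrime)
    (hmodD : nonempty_modularParametrizationData) (hp2 : p ≠ 2)
    (hX : ClassX3Gord W p) (he : semistabilityIndex W p = 2)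
    (hX₁ : ClassX3Gord W₁ p) (he₁ : semistabilityIndex W₁ p = 2) {r₁ : ℕ}
    (hr₁ : r₁ ≤ W₁.mordellWeilRank) (htors : ¬ p ∣ W.torsionOrder) (hT : TorsionIso W W₁ p)
    (S₀ : Finset (HeightOneSpectrum (𝓞 ℚ))) (hS₀ : ∀ w ∈ S₀, ((p : ℕ) : 𝓞 ℚ) ∉ w.asIdeal)
    (hS : ∀ w : HeightOneSpectrum (𝓞 ℚ), w ∉ S₀ → ((p : ℕ) : 𝓞 ℚ) ∉ w.asIdeal →
      W.HasGoodReductionAt w)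
    (hS₁ : ∀ w : HeightOneSpectrum (𝓞 ℚ), w ∉ S₀ → ((p : ℕ) : 𝓞 ℚ) ∉ w.asIdeal →
      W₁.HasGoodReductionAt w)
    {b : ℕ} (hb : (b : ℤ) ≤ r₁ + ∑ w ∈ S₀, ((delta W₁ p w : ℤ) - (delta W p w : ℤ))) :
    BudgetLeLambdaAt p W b :=
  hX.budgetLeLambdaAt_of_gv_of_gordPartner_of_congr hGV hGrK hp2 he hX₁ he₁ htors hT S₀ hS₀ hS hS₁
    (fun hκ hγ hγ' D₁ _ ↦
      hX₁.isTorsion_and_le_lambdaInvariant_of_wuthrichHalf hW16 hmodD hp2 he₁ hr₁ hκ hγ hγ' D₁) hb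

/-- **X3♯(G-ord) ∩ `I₀*` row, X3♯(M) partner of rank `≥ r₁` (odd `p`) — NO partner certificate, NO
schema hypothesis**, mod `hGrK` | A40/A41 (§1 + g6's `ClassX3M.isTorsion_and_le_lambdaInvariant_of_wuthrichHalf`).
PER PAIR; nothing booked.
[cite: GreenbergVatsal2000, §2 Prop. (2.8) with Remark (2.9), Cor. (2.3), Prop. (2.4), pp. 26–27 (arXiv:math/9906215)]
[cite: Wuthrich2014, Thm. 16 (p. 397)] [cite: GreenbergLNM1716, Prop. 4.14, §3 Lemma 3.1]
[cite: SilvermanATAEC1994, Ch. V Thm. 5.3, Cor. 5.4] -/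
theorem ClassX3Gord.budgetLeLambdaAt_of_gv_of_multPartner_of_rank
    (hGV : muLambdaAlg_transfer_of_torsionIso_potOrd_of_not_dvd_torsionOrder)
    (hGrK : imKummer_ge_strictCondition_goodOrdinary)
    (hW16 : Wuthrich2014.thm16_halfEigenCharIdeal_dvd_cyclotomicPrime)
    (hmodD : nonempty_modularParametrizationData)
    (hT40 : Silverman1994_thmV53_tateUniformisation.{0})
    (hT41 : Silverman1994_thmV53_corV54_tateUniformisation.{0})
    (hX : ClassX3Gord W p) (he : semistabilityIndex W p = 2)
    (hX₁ : ClassX3M W₁ p) {r₁ : ℕ} (hr₁ : r₁ ≤ W₁.mordellWeilRank)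
    (htors : ¬ p ∣ W.torsionOrder) (hT : TorsionIso W W₁ p)
    (S₀ : Finset (HeightOneSpectrum (𝓞 ℚ))) (hS₀ : ∀ w ∈ S₀, ((p : ℕ) : 𝓞 ℚ) ∉ w.asIdeal)
    (hS : ∀ w : HeightOneSpectrum (𝓞 ℚ), w ∉ S₀ → ((p : ℕ) : 𝓞 ℚ) ∉ w.asIdeal →
      W.HasGoodReductionAt w)
    (hS₁ : ∀ w : HeightOneSpectrum (𝓞 ℚ), w ∉ S₀ → ((p : ℕ) : 𝓞 ℚ) ∉ w.asIdeal →
      W₁.HasGoodReductionAt w)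
    {b : ℕ} (hb : (b : ℤ) ≤ r₁ + ∑ w ∈ S₀, ((delta W₁ p w : ℤ) - (delta W p w : ℤ))) :
    BudgetLeLambdaAt p W b :=
  hX.budgetLeLambdaAt_of_gv_of_multPartner_of_congr hGV hGrK hT40 hT41 he hX₁ htors hT S₀ hS₀ hS hS₁
    (fun hκ hγ hγ' D₁ _ ↦
      hX₁.isTorsion_and_le_lambdaInvariant_of_wuthrichHalf hW16 hmodD hr₁ hκ hγ hγ' D₁) hb

end Summit.BirchSwinnertonDyer.Rank1Residual.Additive

end
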